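import Mathlib
import HarnessLib

/-!
# The determinant of a skew-symmetric matrix is its even-cycle expansion (GCT I, eq. (6))

K. Mulmuley, M. Sohoni, *Geometric complexity theory I*, SIAM J. Comput. 31 (2001) 496–526
[bib `MulmuleySohoniSIAM2001`], §4.2 (authors' version p.17, text of record
`run/shared/lean/pub/val-lit/bip/texts/MS2001-authorversion/all.txt` L1184–1203), on the
skew-symmetric Tutte matrix `M` of a graph:

> "We have `det(M) = ∑_σ sign(σ) wt(σ)`, where `σ` ranges over all permutations of `[1, …, m]`,
> and `wt(σ)` is the product of the entries `M_{iσ(i)}`. Define the cycle graph of `σ` with nonzero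
> weight to be the subgraph of `G` formed by the edges `(i, σ(i))`. Then it is known and easy to
> see that `det(M) = ∑_{σ'} sign(σ') wt(σ')`, (6) where `σ'` ranges over only those permutations
> with nonzero weight whose cycle graphs contain only cycles of even length—the contributions of
> other permutations cancel out."

## What is here (PROVED, no facts, no new notions)

* `det_eq_sum_filter_cycleType_even_of_skew` — **eq. (6)** for an arbitrary SKEW-SYMMETRIC square
  matrix over a commutative ring (`M j i = - M i j` for all `i, j`; the diagonal is not assumed to
  vanish): `det M = ∑_{σ : all nontrivial cycles of σ have even length} sign σ · ∏_i M_{σ(i), i}`.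
  The permutations with a cycle of odd length `≥ 3` cancel in pairs: reversing the odd cycle
  through the least point lying on an odd cycle (`MS2001Eq6.rev`) preserves the sign and
  multiplies the weight by `(-1)^{odd} = -1` (`Finset.sum_involution`).
* `det_eq_sum_filter_cycleType_even_of_alternating` — for an ALTERNATING matrix (skew-symmetric
  with zero diagonal, e.g. a Tutte matrix) the sum may be further restricted to fixed-point-free
  such permutations ("permutations with nonzero weight whose cycle graphs contain only cycles of
  even length").

Mathlib's `Matrix.det_apply` convention `∏_i M (σ i) i` is used for `wt(σ)` (the print's
`∏_i M_{i σ(i)}` is the same sum after `σ ↦ σ⁻¹`, which preserves sign and cycle type).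
Classical (Tutte 1947; Lovász–Plummer, *Matching Theory*, §8.2); recorded here as printed in
GCT I. Honest framing: textbook linear algebra; nothing here bears on any separation.

## References

* [MulmuleySohoniSIAM2001] K. Mulmuley, M. Sohoni, *Geometric complexity theory I*, SIAM J.
  Comput. 31 (2001) 496–526, §4.2 eq. (6) (AV p.17, all.txt L1184–1203).
-/

namespace Literature.LinearAlgebra.Matrix

open Equiv Equiv.Perm Finset

variable {α : Type*} [Fintype α] [DecidableEq α]

namespace MS2001Eq6

/-! ## §1. Reversing one cycle of a permutation -/

omit [Fintype α] [DecidableEq α] in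
/-- Powers of two permutations that agree on an invariant set agree there. [folklore] -/
private theorem pow_apply_eq_of_eqOn {f g : Perm α} {S : Set α} (hS : ∀ y ∈ S, f y ∈ S)
    (hfg : ∀ y ∈ S, f y = g y) {x : α} (hx : x ∈ S) :
    ∀ i : ℕ, (f ^ i) x = (g ^ i) x ∧ (f ^ i) x ∈ S
  | 0 => by simpa using hx
  | i + 1 => by
    obtain ⟨h1, h2⟩ := pow_apply_eq_of_eqOn hS hfg hx i
    refine ⟨?_, ?_⟩
    · rw [pow_succ', pow_succ', Perm.mul_apply, Perm.mul_apply, ← h1]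
      exact hfg _ h2
    · rw [pow_succ', Perm.mul_apply]
      exact hS _ h2

omit [DecidableEq α] in
/-- Two permutations that agree on an invariant set containing `x` have the same cycle through
`x`. [folklore] -/
private theorem sameCycle_iff_of_eqOn {f g : Perm α} {S : Set α} (hS : ∀ y ∈ S, f y ∈ S)
    (hfg : ∀ y ∈ S, f y = g y) {x : α} (hx : x ∈ S) (y : α) :
    SameCycle f x y ↔ SameCycle g x y := by
  have hgS : ∀ y ∈ S, g y ∈ S := fun y hy => by rw [← hfg y hy]; exact hS y hy
  have hgf : ∀ y ∈ S, g y = f y := fun y hy => (hfg y hy).symm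
  constructor
  · intro h
    obtain ⟨i, hi⟩ := h.exists_nat_pow_eq
    rw [(pow_apply_eq_of_eqOn hS hfg hx i).1] at hi
    rw [← hi]
    exact sameCycle_pow_right.2 (SameCycle.refl g x)
  · intro h
    obtain ⟨i, hi⟩ := h.exists_nat_pow_eq
    rw [(pow_apply_eq_of_eqOn hgS hgf hx i).1] at hi
    rw [← hi]
    exact sameCycle_pow_right.2 (SameCycle.refl f x)

omit [Fintype α] [DecidableEq α] in
/-- `SameCycle σ a (σ⁻¹ y) ↔ SameCycle σ a y`. [folklore] -/
private theorem sameCycle_inv_apply_right' {σ : Perm α} {a y : α} :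
    SameCycle σ a (σ⁻¹ y) ↔ SameCycle σ a y := by
  rw [← sameCycle_inv, sameCycle_apply_right, sameCycle_inv]

omit [Fintype α] [DecidableEq α] in
/-- `σ⁻¹ (σ x) = x`. [folklore] -/
private theorem perm_inv_apply_self (σ : Perm α) (x : α) : σ⁻¹ (σ x) = x :=
  σ.symm_apply_apply x

omit [Fintype α] [DecidableEq α] in
/-- `σ (σ⁻¹ x) = x`. [folklore] -/
private theorem perm_apply_inv_self (σ : Perm α) (x : α) : σ (σ⁻¹ x) = x :=
  σ.apply_symm_apply x

/-- The permutation `σ` with its cycle through `a` REVERSED (the other cycles unchanged).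
[cite: MulmuleySohoniSIAM2001, §4.2 eq. (6) (AV p.17, all.txt L1199–1203)] -/
def rev (σ : Perm α) (a : α) : Perm α :=
  (σ.cycleOf a)⁻¹ * ((σ.cycleOf a)⁻¹ * σ)

/-- Pointwise description of the reversal: `σ⁻¹` on the cycle of `a`, `σ` elsewhere.
[cite: MulmuleySohoniSIAM2001, §4.2 eq. (6) (AV p.17, all.txt L1199–1203)] -/
theorem rev_apply (σ : Perm α) (a y : α) :
    rev σ a y = if σ.SameCycle a y then σ⁻¹ y else σ y := by
  rw [rev, Perm.mul_apply, Perm.mul_apply, cycleOf_inv, cycleOf_apply, cycleOf_apply]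
  by_cases h : σ.SameCycle a y
  · have h1 : SameCycle σ⁻¹ a (σ y) := by rw [sameCycle_inv, sameCycle_apply_right]; exact h
    have h2 : SameCycle σ⁻¹ a y := by rw [sameCycle_inv]; exact h
    rw [if_pos h1, perm_inv_apply_self, if_pos h2, if_pos h]
  · have h1 : ¬ SameCycle σ⁻¹ a (σ y) := by rw [sameCycle_inv, sameCycle_apply_right]; exact h
    rw [if_neg h1, if_neg h1, if_neg h]

/-- The reversal has the same cycles (as sets). [cite: MulmuleySohoniSIAM2001, §4.2 eq. (6) (AV p.17, all.txt L1199–1203)] -/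
theorem sameCycle_rev_iff (σ : Perm α) (a x y : α) :
    (rev σ a).SameCycle x y ↔ σ.SameCycle x y := by
  by_cases hx : σ.SameCycle a x
  · -- on the cycle of `a`, `rev` agrees with `σ⁻¹`
    have h := sameCycle_iff_of_eqOn (f := σ⁻¹) (g := rev σ a) (S := {y | σ.SameCycle a y})
      (fun y hy => sameCycle_inv_apply_right'.2 hy)
      (fun y (hy : σ.SameCycle a y) => by rw [rev_apply, if_pos hy]) hx y
    rw [sameCycle_inv] at h
    exact h.symm
  · -- off the cycle of `a`, `rev` agrees with `σ`
    have h := sameCycle_iff_of_eqOn (f := σ) (g := rev σ a) (S := {y | ¬ σ.SameCycle a y})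
      (fun y (hy : ¬ σ.SameCycle a y) => show ¬ σ.SameCycle a (σ y) by
        rw [sameCycle_apply_right]; exact hy)
      (fun y (hy : ¬ σ.SameCycle a y) => by rw [rev_apply, if_neg hy]) hx y
    exact h.symm

/-- The reversal moves the same points. [cite: MulmuleySohoniSIAM2001, §4.2 eq. (6) (AV p.17, all.txt L1199–1203)] -/
theorem support_rev (σ : Perm α) (a : α) : (rev σ a).support = σ.support := by
  ext y
  rw [mem_support, mem_support, rev_apply]
  split_ifs
  · rw [Ne, Perm.inv_eq_iff_eq, eq_comm]
  · exact Iff.rfl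

/-- The reversal has the same cycle supports. [cite: MulmuleySohoniSIAM2001, §4.2 eq. (6) (AV p.17, all.txt L1199–1203)] -/
theorem support_cycleOf_rev (σ : Perm α) (a x : α) :
    ((rev σ a).cycleOf x).support = (σ.cycleOf x).support := by
  ext y
  rw [mem_support_cycleOf_iff, mem_support_cycleOf_iff, sameCycle_rev_iff, support_rev]

/-- The reversal has the same sign. [cite: MulmuleySohoniSIAM2001, §4.2 eq. (6) (AV p.17, all.txt L1199–1203)] -/
theorem sign_rev (σ : Perm α) (a : α) : sign (rev σ a) = sign σ := by
  rw [rev, Perm.sign_mul, Perm.sign_mul, Perm.sign_inv, ← mul_assoc, Int.units_mul_self, one_mul]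

/-- Reversing it twice gives `σ` back. [cite: MulmuleySohoniSIAM2001, §4.2 eq. (6) (AV p.17, all.txt L1199–1203)] -/
theorem rev_rev (σ : Perm α) (a : α) : rev (rev σ a) a = σ := by
  ext y
  rw [rev_apply]
  by_cases h : σ.SameCycle a y
  · rw [if_pos ((sameCycle_rev_iff σ a a y).2 h), Perm.inv_eq_iff_eq, rev_apply,
      if_pos (sameCycle_apply_right.2 h), perm_inv_apply_self]
  · rw [if_neg (fun h' => h ((sameCycle_rev_iff σ a a y).1 h')), rev_apply, if_neg h]

/-- Reversing an ODD cycle of length `≥ 3` changes the permutation. [cite: MulmuleySohoniSIAM2001, §4.2 eq. (6) (AV p.17, all.txt L1199–1203)] -/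
theorem rev_ne (σ : Perm α) {a : α} (ha : a ∈ σ.support)
    (hodd : Odd (σ.cycleOf a).support.card) : rev σ a ≠ σ := by
  intro h
  have ha' : σ a ≠ a := mem_support.1 ha
  have key : ∀ y, σ.SameCycle a y → σ⁻¹ y = σ y := fun y hy => by
    have := Equiv.congr_fun h y
    rwa [rev_apply, if_pos hy] at this
  -- the cycle through `a` squares to the identity
  have hsq : σ.cycleOf a ^ 2 = 1 := by
    ext y
    rw [sq, Perm.mul_apply, Perm.one_apply, cycleOf_apply σ a y]
    by_cases hy : σ.SameCycle a y
    · rw [if_pos hy, cycleOf_apply, if_pos (sameCycle_apply_right.2 hy)]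
      have := key (σ y) (sameCycle_apply_right.2 hy)
      rw [perm_inv_apply_self] at this
      exact this.symm
    · rw [if_neg hy, cycleOf_apply, if_neg hy]
  have hcyc : (σ.cycleOf a).IsCycle := isCycle_cycleOf σ ha'
  have hdvd : (σ.cycleOf a).support.card ∣ 2 := by
    rw [← hcyc.orderOf]
    exact orderOf_dvd_of_pow_eq_one hsq
  have h2 : 2 ≤ (σ.cycleOf a).support.card := two_le_card_support_cycleOf_iff.2 ha'
  have hle : (σ.cycleOf a).support.card ≤ 2 := Nat.le_of_dvd two_pos hdvd
  have heq : (σ.cycleOf a).support.card = 2 := le_antisymm hle h2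
  rw [heq] at hodd
  exact (Nat.not_odd_iff_even.2 even_two) hodd

/-- **The weight of the reversal**: reversing the cycle `C` through `a` of a skew-symmetric
matrix's permutation term multiplies `∏_i M_{σ(i), i}` by `(-1)^{#C}`.
[cite: MulmuleySohoniSIAM2001, §4.2 eq. (6) (AV p.17, all.txt L1199–1203)] -/
theorem prod_rev {R : Type*} [CommRing R] {M : Matrix α α R} (hskew : ∀ i j, M j i = -M i j)
    (σ : Perm α) {a : α} (ha : a ∈ σ.support) :
    ∏ i, M (rev σ a i) i = (-1) ^ (σ.cycleOf a).support.card * ∏ i, M (σ i) i := by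
  have ha' : σ a ≠ a := mem_support.1 ha
  set C := (σ.cycleOf a).support with hC
  have hmem : ∀ y, y ∈ C ↔ σ.SameCycle a y := fun y => mem_support_cycleOf_iff' ha'
  -- split both products along `C` and its complement
  rw [← prod_mul_prod_compl C (fun i => M (rev σ a i) i),
    ← prod_mul_prod_compl C (fun i => M (σ i) i)]
  have hcompl : ∏ i ∈ Cᶜ, M (rev σ a i) i = ∏ i ∈ Cᶜ, M (σ i) i := by
    refine prod_congr rfl fun i hi => ?_
    rw [mem_compl, hmem] at hi
    rw [rev_apply, if_neg hi]
  have hcyc : ∏ i ∈ C, M (rev σ a i) i = (-1) ^ C.card * ∏ i ∈ C, M (σ i) i := by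
    calc ∏ i ∈ C, M (rev σ a i) i = ∏ i ∈ C, M (σ⁻¹ i) i := by
          refine prod_congr rfl fun i hi => ?_
          rw [rev_apply, if_pos ((hmem i).1 hi)]
      _ = ∏ j ∈ C, M j (σ j) := by
          refine prod_nbij' (fun i => σ⁻¹ i) (fun j => σ j) (fun i hi => ?_) (fun j hj => ?_)
            (fun i _ => perm_apply_inv_self σ i) (fun j _ => perm_inv_apply_self σ j)
            (fun i _ => by rw [perm_apply_inv_self])
          · rw [hmem] at hi ⊢; exact sameCycle_inv_apply_right'.2 hi
          · rw [hmem] at hj ⊢; exact sameCycle_apply_right.2 hj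
      _ = ∏ j ∈ C, (-1) * M (σ j) j := by
          refine prod_congr rfl fun j _ => ?_
          rw [hskew (σ j) j, neg_one_mul]
      _ = (-1) ^ C.card * ∏ i ∈ C, M (σ i) i := by
          rw [prod_mul_distrib, prod_const]
  rw [hcompl, hcyc, mul_assoc]

/-! ## §2. The points lying on odd cycles -/

/-- The points of `σ` lying on a cycle of ODD length (`≥ 3`). [cite: MulmuleySohoniSIAM2001, §4.2 eq. (6) (AV p.17, all.txt L1199–1203)] -/
def oddStart (σ : Perm α) : Finset α :=
  univ.filter fun x => x ∈ σ.support ∧ Odd (σ.cycleOf x).support.card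

/-- The reversal has the same odd-cycle points. [cite: MulmuleySohoniSIAM2001, §4.2 eq. (6) (AV p.17, all.txt L1199–1203)] -/
theorem oddStart_rev (σ : Perm α) (a : α) : oddStart (rev σ a) = oddStart σ := by
  ext x
  simp only [oddStart, mem_filter, mem_univ, true_and, support_rev, support_cycleOf_rev]

/-- A permutation has a cycle of odd length (`≥ 3`) iff some moved point lies on an odd cycle.
[cite: MulmuleySohoniSIAM2001, §4.2 eq. (6) (AV p.17, all.txt L1199–1203)] -/
theorem exists_odd_cycleType_iff (σ : Perm α) :
    (∃ c ∈ σ.cycleType, Odd c) ↔ (oddStart σ).Nonempty := by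
  constructor
  · rintro ⟨c, hc, hodd⟩
    rw [cycleType_def, Multiset.mem_map] at hc
    obtain ⟨g, hg, rfl⟩ := hc
    have hg' : g ∈ σ.cycleFactorsFinset := hg
    obtain ⟨x, hx⟩ := (mem_cycleFactorsFinset_iff.1 hg').1.nonempty_support
    refine ⟨x, mem_filter.2 ⟨mem_univ _, mem_cycleFactorsFinset_support_le hg' hx, ?_⟩⟩
    rw [← cycle_is_cycleOf hx hg']
    exact hodd
  · rintro ⟨x, hx⟩
    obtain ⟨hxs, hodd⟩ := (mem_filter.1 hx).2
    refine ⟨_, ?_, hodd⟩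
    rw [cycleType_def, Multiset.mem_map]
    exact ⟨σ.cycleOf x, cycleOf_mem_cycleFactorsFinset_iff.2 hxs, rfl⟩

end MS2001Eq6

open MS2001Eq6

/-! ## §3. Eq. (6) -/

/-- **GCT I, eq. (6): the determinant of a skew-symmetric matrix is its even-cycle expansion**
(AV p.17, all.txt L1195–1203: "it is known and easy to see that `det(M) = ∑_{σ'} sign(σ')
wt(σ')`, where `σ'` ranges over only those permutations … whose cycle graphs contain only cycles
of even length—the contributions of other permutations cancel out"). For every square matrix `M`
over a commutative ring with `M_{ji} = -M_{ij}` for all `i, j`: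
`det M = ∑_{σ : every (nontrivial) cycle of σ has even length} sign σ · ∏_i M_{σ(i), i}`. The
permutations having a cycle of odd length `≥ 3` cancel in pairs under reversal of the odd cycle
through their least odd-cycle point (same sign, weight multiplied by `(-1)^{odd}`); fixed points
are not excluded here (no hypothesis on the diagonal is needed; see
`det_eq_sum_filter_cycleType_even_of_alternating`).
[cite: MulmuleySohoniSIAM2001, §4.2 eq. (6) (AV p.17, all.txt L1195–1203)] -/
theorem det_eq_sum_filter_cycleType_even_of_skew {R : Type*} [CommRing R] {M : Matrix α α R}
    (hskew : ∀ i j, M j i = -M i j) :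
    M.det = ∑ σ ∈ univ.filter (fun σ : Perm α => ∀ c ∈ σ.cycleType, Even c),
      Equiv.Perm.sign σ • ∏ i, M (σ i) i := by
  classical
  letI : LinearOrder α := LinearOrder.lift' (Fintype.equivFin α) (Fintype.equivFin α).injective
  rw [Matrix.det_apply, ← sum_filter_add_sum_filter_not univ
    (fun σ : Perm α => ∀ c ∈ σ.cycleType, Even c)]
  suffices hbad : ∑ σ ∈ univ.filter (fun σ : Perm α => ¬ ∀ c ∈ σ.cycleType, Even c),
      Equiv.Perm.sign σ • ∏ i, M (σ i) i = 0 by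
    rw [hbad, add_zero]
  have hbad_iff : ∀ σ : Perm α, (¬ ∀ c ∈ σ.cycleType, Even c) ↔ (oddStart σ).Nonempty := by
    intro σ
    rw [← exists_odd_cycleType_iff]
    simp only [not_forall, Nat.not_even_iff_odd, exists_prop]
  have hne : ∀ σ ∈ univ.filter (fun σ : Perm α => ¬ ∀ c ∈ σ.cycleType, Even c),
      (oddStart σ).Nonempty := fun σ hσ => (hbad_iff σ).1 (mem_filter.1 hσ).2
  -- the canonical odd-cycle point and its properties
  have hpick : ∀ (σ : Perm α) (h : (oddStart σ).Nonempty),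
      (oddStart σ).min' h ∈ σ.support ∧ Odd (σ.cycleOf ((oddStart σ).min' h)).support.card :=
    fun σ h => by
      have := min'_mem (oddStart σ) h
      exact (mem_filter.1 this).2
  refine sum_involution (fun σ hσ => rev σ ((oddStart σ).min' (hne σ hσ))) ?_ ?_ ?_ ?_
  · intro σ hσ
    obtain ⟨ha, hodd⟩ := hpick σ (hne σ hσ)
    rw [sign_rev, prod_rev hskew σ ha, Odd.neg_one_pow hodd, neg_one_mul, smul_neg, add_neg_cancel]
  · intro σ hσ _
    obtain ⟨ha, hodd⟩ := hpick σ (hne σ hσ)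
    exact rev_ne σ ha hodd
  · intro σ hσ
    refine mem_filter.2 ⟨mem_univ _, (hbad_iff _).2 ?_⟩
    rw [oddStart_rev]
    exact hne σ hσ
  · intro σ hσ
    have h1 : (oddStart (rev σ ((oddStart σ).min' (hne σ hσ)))).min'
        (hne _ (mem_filter.2 ⟨mem_univ _, (hbad_iff _).2 (by rw [oddStart_rev]; exact hne σ hσ)⟩)) =
        (oddStart σ).min' (hne σ hσ) := by
      simp only [oddStart_rev]
    rw [h1, rev_rev]

/-- **Eq. (6) for an ALTERNATING matrix** (skew-symmetric with zero diagonal — e.g. the Tutte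
matrix of a graph, AV p.17 L1184–1203): the sum may be restricted to the FIXED-POINT-FREE
permutations all of whose cycles have even length ("permutations with nonzero weight whose cycle
graphs contain only cycles of even length"), since a fixed point `i` contributes the factor
`M_{ii} = 0`. [cite: MulmuleySohoniSIAM2001, §4.2 eq. (6) (AV p.17, all.txt L1184–1203)] -/
theorem det_eq_sum_filter_cycleType_even_of_alternating {R : Type*} [CommRing R]
    {M : Matrix α α R} (hskew : ∀ i j, M j i = -M i j) (hdiag : ∀ i, M i i = 0) :
    M.det = ∑ σ ∈ univ.filter (fun σ : Perm α => (∀ c ∈ σ.cycleType, Even c) ∧ σ.support = univ),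
      Equiv.Perm.sign σ • ∏ i, M (σ i) i := by
  rw [det_eq_sum_filter_cycleType_even_of_skew hskew]
  symm
  rw [← filter_filter]
  refine sum_filter_of_ne fun σ _ hne => ?_
  by_contra hsupp
  apply hne
  obtain ⟨i, hi⟩ : ∃ i, σ i = i := by
    by_contra h
    push Not at h
    exact hsupp (eq_univ_iff_forall.2 fun i => mem_support.2 (h i))
  rw [prod_eq_zero (mem_univ i) (by rw [hi, hdiag]), smul_zero]

end Literature.LinearAlgebra.Matrix
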